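import Summits.BirchSwinnertonDyer.BirchSwinnertonDyer.Theses.KimAtThreeKolyvagin
import HarnessLib

/-! BC3 birth skeleton for crux `KimAtThreeKolyvagin.DeepUpperAtThree` (route KimAtThreeKolyvagin, rung W2):
v2 (A12-admitted shape, planner g12): named stubs (the ONLY sorried declarations) + the kernel-checked composition `DeepUpperAtThree_of` concluding the crux BY NAME. -/

noncomputable section

open scoped MatrixGroups ModularForm Classical

open CongruenceSubgroup WeierstrassCurve Literature.NumberTheory.EllipticCurves
  Literature.NumberTheory.EllipticCurves.ModularForms
  Literature.NumberTheory.EllipticCurves.Kim2025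
  Literature.NumberTheory.EllipticCurves.Rank1Residual
  Literature.NumberTheory.EllipticCurves.Rank1Residual.Typed

set_option linter.dupNamespace false

namespace Summit.BirchSwinnertonDyer.BirchSwinnertonDyer.Cruxes.DeepUpperAtThree.Birth

open Summit.BirchSwinnertonDyer.Rank1Residual.Additive
open Summit.BirchSwinnertonDyer.Rank1Residual.X4
open Summit.BirchSwinnertonDyer.BirchSwinnertonDyer.Theses.KimAtThreeKolyvagin


/-! BC3 birth skeleton for crux `DeepUpperAtThree` (regime split by Kato Thm 14.5 (3)'s pot-good clause). -/

/-- stub (potGood): the upper inequality on the POTENTIALLY GOOD additive stratum `0 ≤ ord₃ j(E)` —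
Kato's own case of Thm. 14.5 (3) ("f potentially of good reduction at p"): the unrefined bound
`ord₃ #Ш ≤ ∂^{(0)}` is the Literature fact `Kato2004.rankZero_padicValNat_sha_le_of_additive_potGood_of_imageContainsSL2`
(BC5 rung); the refinement by `∂^{(∞)}_{deep}` is MR04 Thm 5.2.12 (i) for Kato's Kolyvagin system at `p = 3`
(Sakamoto 2024 in place of (H.4)) + the local lattice Lemma L (Kim–Nakamura 2020 Cor 2.4 / Kim 2026 Lemma 3.10 at `p = 3`). -/
theorem stub_upper_potGood :
  ∀ (W : WeierstrassCurve ℚ) [W.IsElliptic] [W.IsGloballyMinimal],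
    (∀ n : ℕ, W.HasSurjectiveModNGaloisRep (3 ^ n : ℕ)) →
    Finite W.sha →
    ∀ {N : ℕ} [NeZero N] (f : CuspForm (Gamma0 N) 2), IsNewformOf W f →
    (∀ r : ℚ, ratPlusSymbol f r ≠ 0 → 0 ≤ padicValRat 3 (ratPlusSymbol f r)) →
    kuriharaVanishingOrder W 3 f = 0 →
    0 ≤ padicValRat 3 W.j →
      ∃ d : ℕ, kuriharaPartialDeepInfty W 3 f = d ∧
        ((padicValNat 3 (Nat.card (AddCommGroup.primaryComponent W.sha 3)) + d : ℕ) : ℕ∞) ≤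
          kuriharaPartial W 3 f 0 := by
  sorry

/-- stub (potMult): the upper inequality on the POTENTIALLY MULTIPLICATIVE additive stratum `ord₃ j(E) < 0`
(Kodaira `I_n^*` at 3; EXCLUDED from Kato Thm. 14.5 (3) at `k = 2`): the bound must be re-derived through the
quadratic twist to a Tate curve (exp* lattice of the twisted Tate parametrisation; Kato Thm 13.4 (3) is still
available `Λ`-adically, the descent Prop 14.16 (2) needs the pot-mult local index). -/
theorem stub_upper_potMult :
  ∀ (W : WeierstrassCurve ℚ) [W.IsElliptic] [W.IsGloballyMinimal],
    (∀ n : ℕ, W.HasSurjectiveModNGaloisRep (3 ^ n : ℕ)) →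
    Finite W.sha →
    ∀ {N : ℕ} [NeZero N] (f : CuspForm (Gamma0 N) 2), IsNewformOf W f →
    (∀ r : ℚ, ratPlusSymbol f r ≠ 0 → 0 ≤ padicValRat 3 (ratPlusSymbol f r)) →
    kuriharaVanishingOrder W 3 f = 0 →
    padicValRat 3 W.j < 0 →
      ∃ d : ℕ, kuriharaPartialDeepInfty W 3 f = d ∧
        ((padicValNat 3 (Nat.card (AddCommGroup.primaryComponent W.sha 3)) + d : ℕ) : ℕ∞) ≤
          kuriharaPartial W 3 f 0 := by
  sorry

/-- BC3 composition = THE SKELETON (A12 shape, v2): the crux BY NAME with NO hypotheses, from exactly the two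
registered stubs (the two strata `0 ≤ ord₃ j` / `ord₃ j < 0` exhaust the additive locus, `le_or_lt`); kernel-checked,
no sorry of its own. -/
theorem DeepUpperAtThree_of :
    Summit.BirchSwinnertonDyer.BirchSwinnertonDyer.Theses.KimAtThreeKolyvagin.DeepUpperAtThree := by
  intro W _ _ htower hfin N _ f hf hint hord
  by_cases hj : 0 ≤ padicValRat 3 W.j
  · exact stub_upper_potGood W htower hfin f hf hint hord hj
  · exact stub_upper_potMult W htower hfin f hf hint hord (not_le.mp hj)

end Summit.BirchSwinnertonDyer.BirchSwinnertonDyer.Cruxes.DeepUpperAtThree.Birth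

end
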